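import Mathlib
import Literature.NumberTheory.Automorphic.HilbertModularFormQExpansion
import Summits.Langlands.Langlands.Theorems.CapacityClassicalityHilbertIntegralOverconvergentIsCongruenceStubTotallyRealEmbeddings

/-!
# Crux `HilbertIntegralOverconvergentIsCongruence` (stmt-Langlands-8485), line `Sketch-ideate-r1-k1`,
# section L (Fourier expansion on the tube domain): stub `stub_pairing_cubePoint` (L3)

Section L of the line proves the Fourier expansion of a holomorphic `𝓞 F`-periodic function on the
tube domain (Freitag, *Hilbert Modular Forms*, I.4.1) by expanding `x ↦ f(x + iy)` over the torus
characters `e^{2πi n·x}`, `n ∈ ℤ^ι`.  This file proves the registered stub `stub_pairing_cubePoint`,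
the phase bookkeeping matching torus characters with `q`-monomials: in the cube coordinates
`x + iy = (∑_i x_i σ(b_i) + i y_σ)_σ` of the integral basis `b = NumberField.integralBasis F`,
`S(ν(x + iy)) = ∑_σ σ(ν) (∑_i x_i σ(b_i) + i y_σ) = ∑_i n_i x_i + i ∑_σ σ(ν) y_σ`
whenever `n_i = Tr_{F/ℚ}(ν b_i)`, because `∑_σ σ(ν b_i) = Tr_{F/ℚ}(ν b_i)` for a totally real field
(landed stub `stub_totallyReal_embeddings`, part (i)).  The proof is this computation: unfold
`pairing`, `cubePoint`, `realPoint`, push the real casts into `ℂ`, swap the two finite sums.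
-/

set_option linter.dupNamespace false

noncomputable section

namespace Summit.Langlands.Langlands.Theorems.HilbertIntegralOverconvergentIsCongruence

open MeasureTheory Complex NumberField
open Literature.NumberTheory.Automorphic Literature.NumberTheory.Automorphic.HilbertModular

/-- For a totally real field, `∑_σ σ(ν) σ(b_i) = n_i` when `n_i = Tr_{F/ℚ}(ν b_i)`
(`∑_σ σ = Tr_{F/ℚ}`, landed stub `stub_totallyReal_embeddings` (i)). -/
theorem l3_sum_embeddings_mul_integralBasis (F : Type) [Field F] [NumberField F]
    [NumberField.IsTotallyReal F] (ν : F) (n : Module.Free.ChooseBasisIndex ℤ (𝓞 F) → ℤ)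
    (hn : ∀ i, ((n i : ℤ) : ℚ) = Algebra.trace ℚ F (ν * integralBasis F i))
    (i : Module.Free.ChooseBasisIndex ℤ (𝓞 F)) :
    ∑ σ : F →+* ℝ, σ ν * σ (integralBasis F i) = (n i : ℝ) := by
  have h := (stub_totallyReal_embeddings F).1 (ν * integralBasis F i)
  rw [← hn i, eq_ratCast, Rat.cast_intCast] at h
  simpa only [map_mul] using h

/-- The real part of the phase in cube coordinates: `∑_σ σ(ν) x_σ = ∑_i n_i x_i` for
`x_σ = ∑_i x_i σ(b_i)` and `n_i = Tr_{F/ℚ}(ν b_i)`. -/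
theorem l3_sum_embeddings_mul_realPoint (F : Type) [Field F] [NumberField F]
    [NumberField.IsTotallyReal F] (ν : F) (n : Module.Free.ChooseBasisIndex ℤ (𝓞 F) → ℤ)
    (hn : ∀ i, ((n i : ℤ) : ℚ) = Algebra.trace ℚ F (ν * integralBasis F i)) (x : Coord F) :
    ∑ σ : F →+* ℝ, σ ν * realPoint x σ = ∑ i, (n i : ℝ) * x i := by
  simp only [realPoint, Finset.mul_sum]
  rw [Finset.sum_comm]
  refine Finset.sum_congr rfl fun i _ ↦ ?_
  rw [← l3_sum_embeddings_mul_integralBasis F ν n hn i, Finset.sum_mul]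
  exact Finset.sum_congr rfl fun σ _ ↦ by ring

/-- **stub L3 — `stub_pairing_cubePoint`.** In cube coordinates the phase splits as
`S(ν(x + iy)) = n·x + i⟨ν,y⟩` with `n_i = Tr(ν b_i)` (for a totally real field `∑_σ σ = Tr_{F/ℚ}`,
landed as `stub_totallyReal_embeddings`). [folklore] -/
theorem stub_pairing_cubePoint (F : Type) [Field F] [NumberField F] [NumberField.IsTotallyReal F] (ν : F)
    (n : Module.Free.ChooseBasisIndex ℤ (𝓞 F) → ℤ)
    (hn : ∀ i, ((n i : ℤ) : ℚ) = Algebra.trace ℚ F (ν * integralBasis F i))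
    (x : Coord F) (y : (F →+* ℝ) → ℝ) :
    pairing ν (cubePoint x y) =
      ((∑ i, (n i : ℝ) * x i : ℝ) : ℂ) + ((∑ σ : F →+* ℝ, σ ν * y σ : ℝ) : ℂ) * I := by
  rw [← l3_sum_embeddings_mul_realPoint F ν n hn x]
  simp only [pairing, cubePoint]
  push_cast
  rw [Finset.sum_mul, ← Finset.sum_add_distrib]
  exact Finset.sum_congr rfl fun σ _ ↦ by ring

end Summit.Langlands.Langlands.Theorems.HilbertIntegralOverconvergentIsCongruence
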